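import Literature.NumberTheory.Automorphic.ArchRankinSelbergTestVectorRankOne
import HarnessLib

/-!
# Tate's factor of the archimedean `GL₂ × GL₂` Rankin–Selberg integral:
# `∫_{K_∞ˣ} H(c) N(c)^{2s} d^×c` for a radial Gaussian monomial (Tate (1967), §2.5; Humphries–Jo (2024), Lemma 4.5)

Topic `NumberTheory/Automorphic`; namespace `Literature.NumberTheory.Automorphic`. Theorems only (no
definition, no named fact, no instance). The torus reduction of the archimedean Rankin–Selberg integral
(`ArchRankinSelbergTorusReductionGL2`) produces the factor `T(s) = ∫_{K_∞ˣ} ω(c) conj ω'(c) g(c) N(c)^{2s} dμ_c`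
(Humphries–Jo (2024), proof of Prop. 5.2: `∫_{F^×} ω_π ω̄_σ(z) χ_π χ_σ(z/‖z‖) ‖z‖^{c(π)+c(σ)} |z|^{ns} e^{-d_F π ‖z‖²} d^×z
= L(ns, ω_{π_ur} ω_{σ_ur})`, their Lemma 4.5 with (2.1)). Once the compact part of `ω conj ω'` is cancelled
by the degree character of the weight polynomial (`kAverage_kirillov_central_eq_one`,
`ArchRankinSelbergKAverageGL2`), the integrand is a RADIAL Gaussian monomial
`H(c) = ∏_{w real} |c_w|^{p_w} e^{-π c_w²} ∏_{w complex} |c_w|^{q_w} e^{-π |c_w|²}` (`p_w, q_w ∈ ℂ`), and this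
file evaluates, for every Haar measure `μ` on `K_∞ˣ` (`tateFactor_units_eq`):

  `∫_{K_∞ˣ} H(c) N(c)^{2s} dμ(c) = c_μ · ∏_{w real} Γ_ℝ(2s + p_w) · ∏_{w complex} (π/2) 2^{2s + q_w/2} Γ_ℂ(2s + q_w/2)`

for `re(2s + p_w) > 0`, `re(2s + q_w/2) > 0`, with `c_μ > 0` depending only on `μ` — Tate's local
computations `∫_ℝ |x|^{s'-1} e^{-πx²} dx = Γ_ℝ(s')` (`TateArchimedean.zeta_real_trivial`) and
`∫_ℂ (|z|²)^{a-1} e^{-π|z|²} = π^{1-a} Γ(a) = (π/2) 2^a Γ_ℂ(a)`, the Haar measure `d^×c = c_μ dx / N(x)`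
(`exists_integral_units_eq_mul_integral`) and Fubini over the places (`integral_mixedSpace_prod_eq_prod`),
exactly as in the rank-one discharge `HumphriesJo2024_archRankinSelberg_testVector_one`.

## References

* J. Tate, *Fourier analysis in number fields and Hecke's zeta-functions*, in Cassels–Fröhlich (1967),
  Ch. XV, §2.5 (pp. 343–345) [TateThesis1967].
* P. Humphries, Y. Jo, *Test vectors for archimedean period integrals*, Publ. Mat. 68 (2024), §2.3
  (2.1), Lemma 4.5, proof of Prop. 5.2 [HumphriesJo2024].
-/

noncomputable section

open MeasureTheory Measure NumberField NumberField.InfinitePlace NumberField.mixedEmbedding IsDedekindDomain Set Filter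
open scoped MatrixGroups ENNReal NNReal Classical ComplexConjugate

namespace Literature.NumberTheory.Automorphic

variable (K : Type) [Field K] [NumberField K]

attribute [local instance] Literature.MeasureTheory.Group.Units.borelSpace_of_isOpenEmbedding
  Literature.MeasureTheory.Group.hasSummableGeomSeries_of_finiteDimensional

set_option maxHeartbeats 4000000 in
/-- **Tate's factor over `K_∞ˣ`**: for a Haar measure `μ` on `K_∞ˣ` there is `c_μ > 0` such that for all
complex exponents `p_w` (real places), `q_w` (complex places) and `s` with `re(2s + p_w) > 0`,
`re(2s + q_w/2) > 0`, and every `H` on `K_∞ˣ` which is the radial Gaussian monomial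
`H(c) = ∏_{w real} |c_w|^{p_w} e^{-π c_w²} · ∏_{w complex} |c_w|^{q_w} e^{-π |c_w|²}`,
`∫ H(c) N(c)^{2s} dμ(c) = c_μ ∏_{w real} Γ_ℝ(2s + p_w) ∏_{w complex} (π/2) 2^{2s + q_w/2} Γ_ℂ(2s + q_w/2)`.
[cite: TateThesis1967, §2.5 (pp. 343–345)] [cite: HumphriesJo2024, Lemma 4.5 and proof of Prop. 5.2] -/
theorem tateFactor_units_eq [mU : MeasurableSpace ((mixedSpace K)ˣ)] [hmU : BorelSpace ((mixedSpace K)ˣ)]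
    (μ : Measure (mixedSpace K)ˣ) [IsHaarMeasure μ] :
    ∃ cμ : ℝ, 0 < cμ ∧ ∀ (p : {w : InfinitePlace K // IsReal w} → ℂ) (q : {w : InfinitePlace K // IsComplex w} → ℂ)
      (H : (mixedSpace K)ˣ → ℂ) (s : ℂ),
      (∀ w, 0 < (2 * s + p w).re) → (∀ w, 0 < (2 * s + q w / 2).re) →
      (∀ c : (mixedSpace K)ˣ, H c =
        (∏ w, (((|((c : (mixedSpace K)ˣ) : mixedSpace K).1 w| : ℝ) : ℂ)) ^ (p w) *
          (Real.exp (-(Real.pi * (((c : (mixedSpace K)ˣ) : mixedSpace K).1 w) ^ 2)) : ℂ)) *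
        ∏ w, (((‖((c : (mixedSpace K)ˣ) : mixedSpace K).2 w‖ : ℝ) : ℂ) ^ (q w) *
          (Real.exp (-(Real.pi * ‖((c : (mixedSpace K)ˣ) : mixedSpace K).2 w‖ ^ 2)) : ℂ))) →
      ∫ c, H c * ((mixedEmbedding.norm ((c : (mixedSpace K)ˣ) : mixedSpace K) : ℝ) : ℂ) ^ (2 * s) ∂μ =
        cμ * ((∏ w, Complex.Gammaℝ (2 * s + p w)) *
          ∏ w, ((Real.pi / 2 : ℂ) * (2 : ℂ) ^ (2 * s + q w / 2) * Complex.Gammaℂ (2 * s + q w / 2))) := by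
  -- Mathlib's (Borel) measurable structure on `K_∞ˣ`
  have hmU' : mU = Units.instMeasurableSpace := by
    rw [hmU.measurable_eq]
    exact (Literature.MeasureTheory.Group.Units.borelSpace_of_isOpenEmbedding (A := mixedSpace K)).measurable_eq.symm
  subst hmU'
  obtain ⟨cA, hcA, hcAint⟩ := exists_integral_units_eq_mul_integral K μ
  refine ⟨cA, hcA, fun p q H s hp hq hH => ?_⟩
  -- the radial profiles
  let F : {w : InfinitePlace K // IsReal w} → ℝ → ℂ := fun w r =>
    ((r : ℝ) : ℂ) ^ (p w) * ((Real.exp (-(Real.pi * r ^ 2)) : ℝ) : ℂ)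
  let G : {w : InfinitePlace K // IsComplex w} → ℝ → ℂ := fun w r =>
    ((r : ℝ) : ℂ) ^ (q w) * ((Real.exp (-(Real.pi * r ^ 2)) : ℝ) : ℂ)
  let R : mixedSpace K → ℂ := fun x => (∏ w, F w |x.1 w|) * ∏ w, G w ‖x.2 w‖
  let Hf : mixedSpace K → ℂ := fun x => R x * (((mixedEmbedding.norm x : ℝ)) : ℂ) ^ (2 * s)
  have hHf : ∀ c : (mixedSpace K)ˣ,
      H c * ((mixedEmbedding.norm ((c : (mixedSpace K)ˣ) : mixedSpace K) : ℝ) : ℂ) ^ (2 * s) = Hf c := fun c => by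
    rw [hH c]
    simp only [Hf, R, F, G, sq_abs]
  -- the one-variable integrands
  set f₁ : {w : InfinitePlace K // IsReal w} → ℝ → ℂ := fun w r =>
    F w |r| * (((|r| : ℝ)) : ℂ) ^ (2 * s) * (((|r|⁻¹ : ℝ)) : ℂ) with hf₁def
  set g₁ : {w : InfinitePlace K // IsComplex w} → ℂ → ℂ := fun w z =>
    G w ‖z‖ * ((((‖z‖ ^ 2 : ℝ)) : ℂ) ^ (2 * s)) * ((((‖z‖ ^ 2)⁻¹ : ℝ)) : ℂ) with hg₁def
  -- the real factor
  have hFint : ∀ w, ∫ r : ℝ, f₁ w r = Complex.Gammaℝ (2 * s + p w) := by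
    intro w
    rw [← TateArchimedean.zeta_real_trivial (hp w)]
    refine integral_congr_ae ?_
    have h0 : ∀ᵐ r : ℝ, r ≠ 0 := by simp [ae_iff]
    filter_upwards [h0] with r hr
    have ha : (0 : ℝ) < |r| := abs_pos.mpr hr
    have ha0 : (((|r| : ℝ)) : ℂ) ≠ 0 := Complex.ofReal_ne_zero.mpr ha.ne'
    have hsq : (r : ℂ) ^ 2 = (((|r| : ℝ)) : ℂ) ^ 2 := by
      rw [← Complex.ofReal_pow, ← Complex.ofReal_pow, sq_abs]
    simp only [hf₁def, F, sq_abs]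
    rw [Complex.ofReal_inv, ← Complex.cpow_neg_one,
      show 2 * s + p w - 1 = p w + 2 * s + (-1) by ring,
      Complex.cpow_add _ _ ha0, Complex.cpow_add _ _ ha0]
    push_cast
    rw [hsq]
    ring
  -- the complex factor
  have hGint : ∀ w, ∫ z : ℂ, g₁ w z =
        (Real.pi / 2 : ℂ) * (2 : ℂ) ^ (2 * s + q w / 2) * Complex.Gammaℂ (2 * s + q w / 2) := by
    intro w
    have key := integral_complex_normSq_cpow_mul_exp (hq w) Real.pi_pos
    have hlhs : ∫ z : ℂ, g₁ w z =
        ∫ z : ℂ, (((‖z‖ ^ 2 : ℝ)) : ℂ) ^ (2 * s + q w / 2 - 1) * Complex.exp (-Real.pi * (((‖z‖ ^ 2 : ℝ)) : ℂ)) := by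
      refine integral_congr_ae ?_
      have h0 : ∀ᵐ z : ℂ ∂volume, z ≠ 0 := by simp [ae_iff]
      filter_upwards [h0] with z hz
      have hn : 0 < ‖z‖ := norm_pos_iff.mpr hz
      have hn2 : (0 : ℝ) < ‖z‖ ^ 2 := by positivity
      have hn20 : (((‖z‖ ^ 2 : ℝ)) : ℂ) ≠ 0 := Complex.ofReal_ne_zero.mpr hn2.ne'
      simp only [hg₁def, G]
      have h1 : ((‖z‖ : ℂ)) ^ (q w) = (((‖z‖ ^ 2 : ℝ)) : ℂ) ^ (q w / 2) := by
        rw [TateArchimedean.ofReal_sq_cpow hn, mul_div_cancel₀ _ (two_ne_zero' ℂ)]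
      rw [h1, Complex.ofReal_inv, ← Complex.cpow_neg_one,
        show 2 * s + q w / 2 - 1 = q w / 2 + 2 * s + (-1) by ring,
        Complex.cpow_add _ _ hn20, Complex.cpow_add _ _ hn20]
      push_cast
      ring
    rw [hlhs, key, Complex.Gammaℂ_def]
    have hπ0 : (Real.pi : ℂ) ≠ 0 := Complex.ofReal_ne_zero.mpr Real.pi_ne_zero
    have h2π : ((2 * Real.pi : ℂ)) ^ (-(2 * s + q w / 2)) = (2 : ℂ) ^ (-(2 * s + q w / 2)) * (Real.pi : ℂ) ^ (-(2 * s + q w / 2)) := by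
      have h := Complex.mul_cpow_ofReal_nonneg (zero_le_two) Real.pi_pos.le (-(2 * s + q w / 2))
      push_cast at h
      exact h
    have h1π : ((1 / Real.pi : ℂ)) ^ (2 * s + q w / 2) = (Real.pi : ℂ) ^ (-(2 * s + q w / 2)) := by
      rw [one_div, Complex.inv_cpow _ _ (by rw [Complex.arg_ofReal_of_nonneg Real.pi_pos.le]; exact Real.pi_ne_zero.symm),
        Complex.cpow_neg]
    have h2s : (2 : ℂ) ^ (2 * s + q w / 2) * (2 : ℂ) ^ (-(2 * s + q w / 2)) = 1 := by
      rw [← Complex.cpow_add _ _ two_ne_zero, add_neg_cancel, Complex.cpow_zero]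
    rw [h1π, h2π]
    linear_combination -(Real.pi : ℂ) * (Real.pi : ℂ) ^ (-(2 * s + q w / 2)) * Complex.Gamma (2 * s + q w / 2) * h2s
  -- ### the integral over `K_∞ˣ`
  clear_value f₁ g₁ F G
  have h1 : ∫ c, H c * ((mixedEmbedding.norm ((c : (mixedSpace K)ˣ) : mixedSpace K) : ℝ) : ℂ) ^ (2 * s) ∂μ =
      ∫ c : (mixedSpace K)ˣ, Hf (c : mixedSpace K) ∂μ := integral_congr_ae (Eventually.of_forall hHf)
  rw [h1, hcAint Hf]
  -- on `K_∞`: `N(x)⁻¹ Hf(x) = ∏ f₁ ∏ g₁` a.e.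
  have h5 : ∫ x : mixedSpace K, (mixedEmbedding.norm x)⁻¹ • Hf x =
      ∫ x : mixedSpace K, (∏ w, f₁ w (x.1 w)) * ∏ w, g₁ w (x.2 w) := by
    refine integral_congr_ae ?_
    filter_upwards [ae_isUnit_mixedSpace K] with x hx
    have hf₁ : ∀ w, f₁ w (x.1 w) = F w |x.1 w| * (((|x.1 w| : ℝ)) : ℂ) ^ (2 * s) * (((|x.1 w|⁻¹ : ℝ)) : ℂ) :=
      fun w => by rw [hf₁def]
    have hg₁ : ∀ w, g₁ w (x.2 w) = G w ‖x.2 w‖ * ((((‖x.2 w‖ ^ 2 : ℝ)) : ℂ) ^ (2 * s)) * ((((‖x.2 w‖ ^ 2)⁻¹ : ℝ)) : ℂ) :=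
      fun w => by rw [hg₁def]
    simp only [hf₁, hg₁]
    have hN : mixedEmbedding.norm x = (∏ w : {w : InfinitePlace K // IsReal w}, |x.1 w|) *
        ∏ w : {w : InfinitePlace K // IsComplex w}, ‖x.2 w‖ ^ 2 := by
      rw [mixedEmbedding.norm_apply, prod_eq_prod_mul_prod]
      congr 1
      · refine Finset.prod_congr rfl fun w _ => ?_
        rw [normAtPlace_apply_of_isReal w.2, mult_isReal, pow_one, Real.norm_eq_abs]
      · refine Finset.prod_congr rfl fun w _ => ?_
        rw [normAtPlace_apply_of_isComplex w.2, mult_isComplex]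
    simp only [Hf, R, Complex.real_smul, hN]
    rw [Complex.ofReal_mul, Complex.mul_cpow_ofReal_nonneg (Finset.prod_nonneg fun w _ => abs_nonneg _)
        (Finset.prod_nonneg fun w _ => by positivity),
      ofReal_prod_cpow_of_nonneg _ _ (fun w => abs_nonneg _), ofReal_prod_cpow_of_nonneg _ _ (fun w => by positivity),
      mul_inv]
    push_cast
    rw [← Finset.prod_inv_distrib, ← Finset.prod_inv_distrib, Finset.prod_mul_distrib, Finset.prod_mul_distrib,
      Finset.prod_mul_distrib, Finset.prod_mul_distrib]
    ring
  rw [h5, integral_mixedSpace_prod_eq_prod K f₁ g₁]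
  rw [Finset.prod_congr rfl fun w _ => hFint w, Finset.prod_congr rfl fun w _ => hGint w]
  simp only [Complex.real_smul]

end Literature.NumberTheory.Automorphic
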